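import Mathlib.RingTheory.MvPolynomial.Basic
import Mathlib.RingTheory.MvPolynomial.Homogeneous
import Mathlib.RingTheory.MvPowerSeries.Order
import Mathlib.Algebra.CharP.Lemmas
import Mathlib.Algebra.Order.Floor.Ring
import Mathlib.Data.Rat.Floor
import Mathlib.Data.Nat.Choose.Sum
import Mathlib.Algebra.BigOperators.Intervals
import Mathlib.Algebra.BigOperators.Fin
import Mathlib.Tactic.ReduceModChar
import Mathlib.Tactic.LinearCombination
import Mathlib.Tactic.FieldSimp
import HarnessLib

/-!
# Hauser 2010 — wild singularities, kangaroo points and oblique polynomials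

Topic: `Literature/AlgebraicGeometry/Resolution`. Statement source of the summit
`ResolutionOfSingularities` (litbuild): H. Hauser, *On the problem of resolution of singularities
in positive characteristic (Or: a proof we are still waiting for)*, Bull. Amer. Math. Soc. 47
(2010) 1–30. Section letters `§A`–`§M` below are those of the author's text (preprint of
July 28, 2009, identical content); the printed version numbers the same sections.

The summit statement itself (non-embedded resolution in characteristic `p`, Hauser §B
"non-embedded resolution") lives in `ResolutionOfSingularities.lean` (`IsResolution`,
`ResolutionInChar`, named facts `Hironaka1964` = Hauser §A "Theorem (Hironaka 1964)",
`CossartPiltant2019` ⊇ Hauser §B "threefolds"); de Jong's alterations (Hauser §B "Alterations")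
live in `Alterations.lean`. They are not restated here.

This file vendors the *explicit characteristic-`p` material* of the paper — the part that routes
`ResolutionOfSingularities/WeightedInvariant` (calibration: "the char-0 datum increases at kangaroo
points") and `ResolutionOfSingularities/UniformComplexity` ("explicit small char-p examples") point
to. Everything below is a definition with body or a proved theorem; there is no named fact and
no `sorry`.

## Content

* §G, before the Kangaroo Theorem: for `r ∈ ℕ^m` and `c ∈ ℕ`, `phi c r = #{i, rᵢ ≢ 0 mod c}`,
  the residue vector `residues c r`, `size r = |r| = Σ rᵢ`.
* Kangaroo Theorem, conditions (1) and (2) (the arithmetic conditions on the exceptional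
  multiplicities at an antelope point): `OrderCondition p r k : p ∣ |r| + k` and
  `MultiplicityInequality p r : r̄ₘ + … + r̄₁ ≤ (φ_p(r) − 1)·p` (residues mod `p`).
  Proved: Remark (b) "it implies that at least two exponents `rᵢ` must be prime to `p`"
  (`two_le_phi`); "for surfaces (`m = 2`), condition (2) reads `r₂, r₁ ≢ 0 mod p` and
  `r̄₂ + r̄₁ ≤ p`" (`multiplicityInequality_two_iff`); footnote 15, the equivalent form
  `⌈r̄₁/p⌉ + … + ⌈r̄ₘ/p⌉ > ⌈(r̄₁ + … + r̄ₘ)/p⌉` (`multiplicityInequality_iff_ceil`).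
* §G Example 3: the **hybrid polynomials** `H_k^r(y,w) = Σ_{i=0}^k C(k+r, i+r) yⁱ w^{k−i}` of
  [Ha1] (`hybrid k r y w`), with the identity `yʳ·H_k^r(y,w) = ⌊y^{-r}(y+w)^{k+r}⌋_poly` proved in
  the two forms `pow_mul_hybrid` and `add_pow_eq`; the surface oblique form
  `yʳ zˢ H_k^r(y, tz − y)`; Blanco's observation that for `p = k = 2`, `r = s = 3` it collapses to
  the square `t·y⁴z⁴` in characteristic 2 (`exampleThree_char_two`), and the alternative form
  `y³z³(y² + t²z²)` whose residual factor is again a square in characteristic 2.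
* §I: **oblique polynomials**. `IsPthPowerExponent`, `deletePthPowers p P` (delete all monomials
  that are `p`-th powers), `orderAwayFrom j P` (order with respect to the variables other than
  `y_j`), `pOrderAwayFrom` (`ord_z^p`), `shear j t P` (`P⁺(y) = P(y + t·y_j)`, `t_j = 0`), and the
  predicate `IsPreOblique p j r k P` transcribing Hauser's definition *except* the normalising clause
  "no non-trivial `p`-th power polynomial factor" (see the rendering note on `IsPreOblique`: read
  literally it excludes the paper's own oblique polynomials). Example 4 is verified end to end:
  `P⁺ = y₂y₁²(y₁ + y₂)` in characteristic 2 (`exampleFour_char_two`, `shear_exampleFour`), deleting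
  squares leaves `y₁³y₂` (`deletePthPowers_shear_exampleFour`), "`P⁺` has modulo squares order 3 with
  respect to `y₁`" (`pOrderAwayFrom_exampleFour`), hence `isPreOblique_exampleFour`; likewise for the
  §K / Example 5 polynomial `y₂³y₁³(y₂² + y₁²)` (`pOrderAwayFrom_exampleFive = 3 = k + 1`,
  `isPreOblique_exampleFive`).
* §C: `ordZero P`, the order of (the Taylor expansion at the origin of) a polynomial, as the
  `MvPowerSeries.order` of `P`.
* §K "Example": the simplest wild singularity / kangaroo point, characteristic 2: the equations
  `f⁰ … f³` (`exampleK0 … exampleK3`), the three point-blowup substitutions and the final coordinate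
  change as ring identities (`exampleK0_blowup`, `exampleK1_blowup`, `exampleK2_blowup` — this one
  and `exampleK3_shift` need characteristic 2), the square `y³z³(y² + z²) = y³z³(y + z)²` at the
  antelope point, and the two residual orders `ord (y² + z²) = 2 < 3 = ord (y⁵ + y⁴ + y³)` behind
  "`shade_{a₃} f³ = 3 > 2 = shade_{a₂} f²`" (`ordZero_exampleK_antelope`, `ordZero_exampleK_kangaroo`).

## Not vendored (and why)

* §E–§G: coefficient ideal `coeff_V J`, weak maximal contact, the shade `shade_a J`, kangaroo /
  antelope / oasis points, **Moh's bound** (§F Proposition, [Mo]) and the **Kangaroo Theorem**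
  (§G) as propositions: they quantify over all smooth local formal hypersurfaces `V` transversal to
  `D` in `𝒪̂_{W,a}` and over transforms under local blowups; stating them faithfully needs a
  formal-power-series theory of coefficient ideals and weak/strict transforms that neither Mathlib
  nor the tree has (an XL definition request, to be filed by the route that needs `(h : MohBound)`).
* §B "embedded resolution", normal crossings, blowups of schemes: Mathlib has no blowup / SNC
  divisor yet; the summit is the non-embedded statement and does not need them.
* §C "Fact" (`ord_{a'} X' ≤ ord_a X` under blowup in a smooth centre inside `top(X)`) and §J "Fact"
  (`shade_a f ≤ ⌊shade_{a°} f°/2⌋` between oasis and antelope point): classical / [Ha1], same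
  missing infrastructure.
* Kangaroo Theorem (4) / §I uniqueness of the oblique polynomial "up to `p`-th powers and choice
  of coordinates": the normalisation is not made precise enough in the text to transcribe.

## Sources

* H. Hauser, *On the problem of resolution of singularities in positive characteristic*, Bull.
  AMS 47 (2010) 1–30, §§C, G (Kangaroo Theorem, Remarks, Example 3), I (oblique polynomials,
  Example 4, 5), K (Example).
* T.-T. Moh, *On a stability theorem for local uniformization in characteristic p*, Publ. RIMS 23
  (1987) 965–973 (Moh's bound; not vendored).
-/

noncomputable section

open MvPolynomial Finset

open scoped BigOperators

namespace Literature.AlgebraicGeometry.Resolution.Hauser2010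

/-! ## §G — arithmetic of the exceptional multiplicities -/

section Multiplicities

variable {ι : Type*} [Fintype ι]

/-- `φ_c(r) = #{i ≤ m, rᵢ ≢ 0 mod c}`: the number of components of the exceptional multiplicity
vector `r ∈ ℕ^m` not divisible by `c` (Hauser 2010, §G, before the Kangaroo Theorem).
[cite: Hauser2010, §G (definition of φ_c)] -/
def phi (c : ℕ) (r : ι → ℕ) : ℕ :=
  #{i | ¬ c ∣ r i}

/-- The residue vector `r^c = (r̄ₘ, …, r̄₁)`, `0 ≤ r̄ᵢ < c` the residue of `rᵢ` modulo `c`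
(Hauser 2010, §G). For `c = 0` Lean's convention `n % 0 = n` applies (never used: `c = p` prime).
[cite: Hauser2010, §G (definition of r^c)] -/
def residues (c : ℕ) (r : ι → ℕ) : ι → ℕ := fun i => r i % c

/-- `|r| = rₘ + … + r₁` (Hauser 2010, §G). [cite: Hauser2010, §G (definition of |r|)] -/
def size (r : ι → ℕ) : ℕ := ∑ i, r i

/-- Kangaroo Theorem, condition (1): for `f = xᵖ + yʳ·g(y)` with `ord g = k` (the shade), "the
order `|r| + ord_a g` of `yʳ g(y)` is a multiple of `p`". [cite: Hauser2010, §G Kangaroo Theorem (1)] -/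
def OrderCondition (p : ℕ) (r : ι → ℕ) (k : ℕ) : Prop :=
  p ∣ size r + k

/-- Kangaroo Theorem, condition (2), the arithmetic inequality on the exceptional multiplicities at
an antelope point: `r̄ₘ + … + r̄₁ ≤ (φ_p(r) − 1)·p` (residues modulo `p`; the right-hand side is
an integer, negative when `φ_p(r) = 0`). [cite: Hauser2010, §G Kangaroo Theorem (2)] -/
def MultiplicityInequality (p : ℕ) (r : ι → ℕ) : Prop :=
  ((∑ i, residues p r i : ℕ) : ℤ) ≤ ((phi p r : ℤ) - 1) * p

/-- `φ_c(r)` as a sum of indicators (cast to `ℤ`). [folklore] -/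
theorem phi_eq_sum_ite (c : ℕ) (r : ι → ℕ) :
    (phi c r : ℤ) = ∑ i, if c ∣ r i then (0 : ℤ) else 1 := by
  unfold phi
  rw [Finset.natCast_card_filter]
  refine Finset.sum_congr rfl fun i _ => ?_
  split_ifs <;> simp_all

/-- `φ_c(r) ≤ m`. [folklore] -/
theorem phi_le_card (c : ℕ) (r : ι → ℕ) : phi c r ≤ Fintype.card ι :=
  Finset.card_filter_le _ _ |>.trans (by simp)

/-- Condition (2) without integer subtraction: `Σ r̄ᵢ + p ≤ φ_p(r)·p`. [folklore] -/
theorem multiplicityInequality_iff (p : ℕ) (r : ι → ℕ) :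
    MultiplicityInequality p r ↔ (∑ i, residues p r i) + p ≤ phi p r * p := by
  unfold MultiplicityInequality
  constructor
  · intro h
    have : ((∑ i, residues p r i : ℕ) : ℤ) + p ≤ (phi p r : ℤ) * p := by linarith
    exact_mod_cast this
  · intro h
    have : ((∑ i, residues p r i : ℕ) : ℤ) + p ≤ (phi p r : ℤ) * p := by exact_mod_cast h
    linarith

/-- Hauser 2010, §G Remark (b): condition (2) "implies that at least two exponents `rᵢ` must be
prime to `p`" (i.e. not divisible by `p`). [cite: Hauser2010, §G Remark (b)] -/
theorem two_le_phi {p : ℕ} (hp : 0 < p) {r : ι → ℕ} (h : MultiplicityInequality p r) :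
    2 ≤ phi p r := by
  rw [multiplicityInequality_iff] at h
  by_contra hlt
  have hphi : phi p r = 1 := by
    rcases Nat.lt_or_ge (phi p r) 1 with h1 | h1
    · have h0 : phi p r = 0 := by omega
      rw [h0] at h
      omega
    · omega
  have hsum : ∑ i, residues p r i = 0 := by
    rw [hphi] at h
    omega
  -- exactly one index is not divisible by `p`; its residue would be positive
  obtain ⟨i, hi⟩ := Finset.card_pos.mp (show 0 < #{i | ¬ p ∣ r i} from by
    change 0 < phi p r; omega)
  simp only [Finset.mem_filter, Finset.mem_univ, true_and] at hi
  have hri : residues p r i = 0 := (Finset.sum_eq_zero_iff.mp hsum) i (Finset.mem_univ i)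
  exact hi (Nat.dvd_of_mod_eq_zero hri)

/-- Hauser 2010, §G Remark (b) / Example 3: "For surfaces (`m = 2`), condition (2) reads
`r₂, r₁ ≢ 0 mod p` and `r₂ + r₁ ≤ p`" (with `rᵢ` read modulo `p`, as in the definition of (2)).
[cite: Hauser2010, §G Remark (b)] -/
theorem multiplicityInequality_two_iff {p : ℕ} (hp : 0 < p) (r : Fin 2 → ℕ) :
    MultiplicityInequality p r ↔ ¬ p ∣ r 0 ∧ ¬ p ∣ r 1 ∧ r 0 % p + r 1 % p ≤ p := by
  rw [multiplicityInequality_iff]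
  simp only [residues, Fin.sum_univ_two, phi]
  have m0 : r 0 % p < p := Nat.mod_lt _ hp
  have m1 : r 1 % p < p := Nat.mod_lt _ hp
  have d0 : p ∣ r 0 ↔ r 0 % p = 0 := Nat.dvd_iff_mod_eq_zero
  have d1 : p ∣ r 1 ↔ r 1 % p = 0 := Nat.dvd_iff_mod_eq_zero
  have hcard : #{i : Fin 2 | ¬ p ∣ r i} =
      (if p ∣ r 0 then 0 else 1) + (if p ∣ r 1 then 0 else 1) := by
    rw [Finset.card_filter, Fin.sum_univ_two]
    by_cases h0 : p ∣ r 0 <;> by_cases h1 : p ∣ r 1 <;> simp [h0, h1]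
  rw [hcard]
  by_cases h0 : p ∣ r 0 <;> by_cases h1 : p ∣ r 1 <;> simp [h0, h1] <;> omega

/-- Hauser 2010, footnote 15: condition (2) "is equivalent to
`⌈r̄₁/p⌉ + … + ⌈r̄ₘ/p⌉ > ⌈(r̄₁ + … + r̄ₘ)/p⌉`, where `⌈u⌉` is the smallest integer `≥ u`".
[cite: Hauser2010, §G footnote 15] -/
theorem multiplicityInequality_iff_ceil {p : ℕ} (hp : 0 < p) (r : ι → ℕ) :
    MultiplicityInequality p r ↔
      ⌈((∑ i, residues p r i : ℕ) : ℚ) / p⌉ < ∑ i, ⌈((residues p r i : ℕ) : ℚ) / p⌉ := by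
  have hp' : (0 : ℚ) < p := by exact_mod_cast hp
  -- each summand on the right is `0` or `1` according to `p ∣ rᵢ`
  have hterm : ∀ i, ⌈((residues p r i : ℕ) : ℚ) / p⌉ = if p ∣ r i then (0 : ℤ) else 1 := by
    intro i
    unfold residues
    split_ifs with h
    · rw [Nat.mod_eq_zero_of_dvd h]; simp
    · rw [Int.ceil_eq_iff]
      have hpos : 0 < r i % p := Nat.pos_of_ne_zero fun h0 => h (Nat.dvd_of_mod_eq_zero h0)
      have hlt : r i % p ≤ p := (Nat.mod_lt _ hp).le
      constructor
      · have : (0 : ℚ) < (r i % p : ℕ) / p := div_pos (by exact_mod_cast hpos) hp'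
        push_cast at this ⊢; linarith
      · rw [div_le_iff₀ hp']; push_cast; exact_mod_cast (by simpa using hlt)
  rw [Finset.sum_congr rfl fun i _ => hterm i, ← phi_eq_sum_ite, MultiplicityInequality]
  have key : ⌈((∑ i, residues p r i : ℕ) : ℚ) / p⌉ < (phi p r : ℤ) ↔
      ((∑ i, residues p r i : ℕ) : ℚ) / p ≤ (((phi p r : ℤ) - 1 : ℤ) : ℚ) := by
    rw [← Int.ceil_le]; omega
  rw [key, div_le_iff₀ hp']
  have e1 : (((phi p r : ℤ) - 1 : ℤ) : ℚ) * (p : ℚ) = ((((phi p r : ℤ) - 1) * p : ℤ) : ℚ) := by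
    push_cast; ring
  have e2 : ((∑ i, residues p r i : ℕ) : ℚ) = (((∑ i, residues p r i : ℕ) : ℤ) : ℚ) := by
    push_cast; rfl
  rw [e1, e2, Int.cast_le]

end Multiplicities

/-! ## §G Example 3 — hybrid polynomials -/

section Hybrid

variable {A : Type*} [CommRing A]

/-- The **hybrid polynomial of type `(r, k)`** of [Ha1], evaluated at `(y, w)`:
`H_k^r(y, w) = Σ_{i=0}^{k} C(k+r, i+r) yⁱ w^{k−i}` (Hauser 2010, §G Example 3).
[cite: Hauser2010, §G Example 3 (hybrid polynomials)] -/
def hybrid (k r : ℕ) (y w : A) : A :=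
  ∑ i ∈ range (k + 1), ((k + r).choose (i + r) : A) * y ^ i * w ^ (k - i)

/-- Hauser 2010, §G Example 3, the rewriting `H_k^r(y,w) = y^{-r}·Σ_{i=0}^k C(k+r, i) y^{k+r−i} wⁱ`,
stated without negative exponents. [cite: Hauser2010, §G Example 3] -/
theorem pow_mul_hybrid (k r : ℕ) (y w : A) :
    y ^ r * hybrid k r y w = ∑ i ∈ range (k + 1), ((k + r).choose i : A) * y ^ (k + r - i) * w ^ i := by
  unfold hybrid
  rw [Finset.mul_sum, ← Finset.sum_range_reflect _ (k + 1)]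
  refine Finset.sum_congr rfl fun i hi => ?_
  have hi : i ≤ k := Nat.lt_succ_iff.mp (Finset.mem_range.mp hi)
  have h1 : k + 1 - 1 - i = k - i := by omega
  have h2 : k - i + r = k + r - i := by omega
  have h3 : k - (k - i) = i := Nat.sub_sub_self hi
  have h4 : (k + r).choose (k + r - i) = (k + r).choose i := Nat.choose_symm (by omega)
  rw [h1, h2, h3, h4, show k + r - i = r + (k - i) by omega, pow_add]
  ring

/-- Hauser 2010, §G Example 3: `yʳ·H_k^r(y,w) = ⌊y^{-r}(y+w)^{k+r}⌋_poly` — the binomial expansion of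
`(y+w)^{k+r}` splits into `yʳ H_k^r(y,w)` (the terms of `w`-degree `≤ k`) and the terms of `w`-degree
`> k` (those acquiring a negative power of `y` after division by `yʳ`). [cite: Hauser2010, §G Example 3] -/
theorem add_pow_eq (k r : ℕ) (y w : A) :
    (y + w) ^ (k + r) = y ^ r * hybrid k r y w +
      ∑ i ∈ Ico (k + 1) (k + r + 1), ((k + r).choose i : A) * y ^ (k + r - i) * w ^ i := by
  rw [pow_mul_hybrid, add_comm y w, add_pow, Finset.range_eq_Ico, Finset.range_eq_Ico,
    ← Finset.sum_Ico_consecutive _ (Nat.zero_le (k + 1)) (by omega : k + 1 ≤ k + r + 1)]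
  congr 1 <;> exact Finset.sum_congr rfl fun i _ => by ring

/-- The surface (`m = 2`) form of the oblique initial form indicated by Kangaroo Theorem (4):
`P(y,z) = yʳ zˢ · H_k^r(y, tz − y)`, `t ≠ 0` locating the kangaroo point on the exceptional divisor
(Hauser 2010, §G Example 3, valid when `C(k+r, k+1) ≢ 0 mod p`). [cite: Hauser2010, §G Example 3] -/
def surfaceObliqueForm (r s k : ℕ) (t y z : A) : A :=
  y ^ r * z ^ s * hybrid k r y (t * z - y)

/-- Hauser 2010, §G Example 3 (R. Blanco's observation), the case `p = k = 2`, `r = s = 3` where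
`C(k+r, k+1) = C(5,3) = 10 ≡ 0 mod 2`: `y³z³·[C(5,3)(tz−y)² + C(5,4)y(tz−y) + C(5,5)y²] = t·y⁴z⁴`
in characteristic 2, a square as soon as `t` is (so it "does not count as oblique"). (The text's
"`r = s = 2`" is a misprint for `3`, as its own display `y³z³·[…]` and Example 5 show.)
[cite: Hauser2010, §G Example 3] -/
theorem exampleThree_char_two [CharP A 2] (t y z : A) :
    surfaceObliqueForm 3 3 2 t y z = t * y ^ 4 * z ^ 4 := by
  simp only [surfaceObliqueForm, hybrid, Finset.sum_range_succ, Finset.sum_range_zero]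
  norm_num [Nat.choose]
  ring_nf
  reduce_mod_char!

/-- Hauser 2010, §G Example 3, the alternative (integration) formula in the same case
`p = k = 2`, `r = s = 3`: `P(y,z) = y³z³·(y² + t²z²)`, whose residual factor is the square
`(y + tz)²` in characteristic 2 (cf. §I Example 5: "`P` has as non-monomial factor `g(y)` the
square `(y₂ + y₁)²`"). [cite: Hauser2010, §G Example 3 and §I Example 5] -/
theorem exampleThree_alt_char_two [CharP A 2] (t y z : A) :
    y ^ 3 * z ^ 3 * (y ^ 2 + t ^ 2 * z ^ 2) = y ^ 3 * z ^ 3 * (y + t * z) ^ 2 := by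
  ring_nf
  reduce_mod_char!

end Hybrid

/-! ## §C — order at the origin -/

section Order

variable {σ : Type*} {K : Type*} [CommSemiring K]

/-- The **order** `ord₀ P` of a polynomial `P` at the origin: the order of its Taylor expansion at
`0`, i.e. the least total degree of a monomial of `P` (`⊤` for `P = 0`); `X = {f = 0}` is singular
at `0` iff `ord₀ f ≥ 2` (Hauser 2010, §C). Realised as the `MvPowerSeries.order` of `P`.
[cite: Hauser2010, §C (order of X at a point)] -/
def ordZero (P : MvPolynomial σ K) : ℕ∞ :=
  (P : MvPowerSeries σ K).order

/-- `ord₀ 0 = ⊤`. [folklore] -/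
theorem ordZero_zero : ordZero (0 : MvPolynomial σ K) = ⊤ := by
  simp [ordZero]

/-- `ord₀ P = n` iff some monomial of degree `n` occurs in `P` and none of smaller degree. [folklore] -/
theorem ordZero_eq_nat_iff (P : MvPolynomial σ K) (n : ℕ) :
    ordZero P = n ↔ (∃ d, coeff d P ≠ 0 ∧ d.degree = n) ∧ ∀ d, d.degree < n → coeff d P = 0 := by
  unfold ordZero
  rw [MvPowerSeries.order_eq_nat]
  simp only [MvPolynomial.coeff_coe]

end Order

/-! ## §I — oblique polynomials -/

section Oblique

variable {σ : Type*} {K : Type*} [CommRing K]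

/-- The exponent `d` of a monomial `y^d` is a **`p`-th power exponent** if every `dᵢ` is divisible by
`p` (so `y^d = (y^{d/p})ᵖ`; over a perfect field of characteristic `p` these are exactly the
monomials `c·y^d` that are `p`-th powers) (Hauser 2010, §I "p-th power monomials"). Phrased over
`d.support` to be decidable. [cite: Hauser2010, §I (definition of oblique, "p-th power monomials")] -/
def IsPthPowerExponent (p : ℕ) (d : σ →₀ ℕ) : Prop :=
  ∀ i ∈ d.support, p ∣ d i

/-- Being a `p`-th power exponent is decidable (finitely many divisibility checks on the support).
[folklore] -/
instance (p : ℕ) : DecidablePred (IsPthPowerExponent (σ := σ) p) := fun d => by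
  unfold IsPthPowerExponent; infer_instance

/-- `d` is a `p`-th power exponent iff `p ∣ dᵢ` for all `i`. [folklore] -/
theorem isPthPowerExponent_iff (p : ℕ) (d : σ →₀ ℕ) : IsPthPowerExponent p d ↔ ∀ i, p ∣ d i := by
  refine ⟨fun h i => ?_, fun h i _ => h i⟩
  by_cases hi : i ∈ d.support
  · exact h i hi
  · rw [Finsupp.notMem_support_iff.mp hi]; exact dvd_zero p

/-- **Deleting the `p`-th power monomials** from `P`: keep exactly the monomials `c·y^d` of `P` whose
exponent `d` is not a `p`-th power exponent (Hauser 2010, §I: "`P⁺` has, after deleting all `p`-th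
power monomials from it, order `k + 1` …"). [cite: Hauser2010, §I (definition of oblique)] -/
def deletePthPowers (p : ℕ) (P : MvPolynomial σ K) : MvPolynomial σ K :=
  ∑ d ∈ P.support with ¬ IsPthPowerExponent p d, monomial d (coeff d P)

/-- Coefficients after deleting the `p`-th power monomials. [folklore] -/
theorem coeff_deletePthPowers [DecidableEq σ] (p : ℕ) (P : MvPolynomial σ K) (d : σ →₀ ℕ) :
    coeff d (deletePthPowers p P) = if IsPthPowerExponent p d then 0 else coeff d P := by
  classical
  simp only [deletePthPowers, coeff_sum, coeff_monomial]
  rw [Finset.sum_ite_eq']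
  by_cases h : IsPthPowerExponent p d
  · simp [h]
  · by_cases hd : d ∈ P.support
    · simp [h, hd]
    · have : coeff d P = 0 := by simpa [MvPolynomial.mem_support_iff] using hd
      simp [h, hd, this]

/-- Deleting `p`-th powers from `0`. [folklore] -/
theorem deletePthPowers_zero (p : ℕ) : deletePthPowers p (0 : MvPolynomial σ K) = 0 := by
  simp [deletePthPowers]

/-- Deleting `p`-th power monomials is additive. [folklore] -/
theorem deletePthPowers_add [DecidableEq σ] (p : ℕ) (P Q : MvPolynomial σ K) :
    deletePthPowers p (P + Q) = deletePthPowers p P + deletePthPowers p Q := by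
  ext d
  simp only [coeff_deletePthPowers, coeff_add]
  split_ifs <;> simp

/-- Deleting `p`-th power monomials from a monomial. [folklore] -/
theorem deletePthPowers_monomial [DecidableEq σ] (p : ℕ) (d : σ →₀ ℕ) (a : K) :
    deletePthPowers p (monomial d a) = if IsPthPowerExponent p d then 0 else monomial d a := by
  ext e
  rw [coeff_deletePthPowers, coeff_monomial]
  by_cases hde : d = e
  · subst hde
    by_cases h : IsPthPowerExponent p d <;> simp [h]
  · by_cases h : IsPthPowerExponent p d <;> simp [h, hde, coeff_monomial]

/-- The **order of `P` with respect to the variables other than `y_j`** (`z = (y_ℓ, …, y₁)` when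
`j = m`): the least `z`-degree `|d| − d_j` of a monomial `y^d` of `P`, `⊤` for `P = 0`
(Hauser 2010, §I "order … with respect to the variables `y_ℓ, …, y₁`").
[cite: Hauser2010, §I (definition of oblique)] -/
def orderAwayFrom (j : σ) (P : MvPolynomial σ K) : ℕ∞ :=
  P.support.inf fun d => ((d.degree - d j : ℕ) : ℕ∞)

/-- The `z`-order of `0` is `⊤`. [folklore] -/
theorem orderAwayFrom_zero (j : σ) : orderAwayFrom j (0 : MvPolynomial σ K) = ⊤ := by
  simp [orderAwayFrom]

/-- `orderAwayFrom j P = n` iff some monomial of `P` has `z`-degree `n` and none has less. [folklore] -/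
theorem orderAwayFrom_eq_natCast_iff (j : σ) (P : MvPolynomial σ K) (n : ℕ) :
    orderAwayFrom j P = n ↔
      (∃ d, coeff d P ≠ 0 ∧ d.degree - d j = n) ∧ ∀ d, coeff d P ≠ 0 → n ≤ d.degree - d j := by
  unfold orderAwayFrom
  constructor
  · intro h
    have hne : P.support.Nonempty := by
      by_contra h0
      rw [Finset.not_nonempty_iff_eq_empty] at h0
      rw [h0, Finset.inf_empty] at h
      exact ENat.top_ne_coe n h
    obtain ⟨d, hd, hdeq⟩ := Finset.exists_mem_eq_inf P.support hne
      (fun d => ((d.degree - d j : ℕ) : ℕ∞))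
    refine ⟨⟨d, MvPolynomial.mem_support_iff.mp hd, ?_⟩, fun e he => ?_⟩
    · exact_mod_cast (hdeq.symm.trans h)
    · have := Finset.inf_le (f := fun d => ((d.degree - d j : ℕ) : ℕ∞))
        (MvPolynomial.mem_support_iff.mpr he)
      rw [h] at this
      exact_mod_cast this
  · rintro ⟨⟨d, hd, hdeq⟩, hmin⟩
    apply le_antisymm
    · have := Finset.inf_le (f := fun d => ((d.degree - d j : ℕ) : ℕ∞))
        (MvPolynomial.mem_support_iff.mpr hd)
      simpa [hdeq] using this
    · refine Finset.le_inf fun e he => ?_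
      exact_mod_cast hmin e (MvPolynomial.mem_support_iff.mp he)

/-- `ord_z^p P`: the order of `P` with respect to the variables other than `y_j`, **modulo `p`-th
powers**, i.e. after deleting the `p`-th power monomials (Hauser 2010, §I, notation `ord_z^p P⁺`).
[cite: Hauser2010, §I (notation ord^p_z)] -/
def pOrderAwayFrom (p : ℕ) (j : σ) (P : MvPolynomial σ K) : ℕ∞ :=
  orderAwayFrom j (deletePthPowers p P)

/-- The substitution `P ↦ P⁺`, `P⁺(y) = P(y + t·y_j)` for a vector `t` with `t_j = 0`:
`y_i ↦ y_i + t_i y_j` (`i ≠ j`), `y_j ↦ y_j` — the coordinate change locating the point `a'` on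
the exceptional divisor (Hauser 2010, §I). [cite: Hauser2010, §I (definition of P⁺)] -/
def shear [DecidableEq σ] (j : σ) (t : σ → K) (P : MvPolynomial σ K) : MvPolynomial σ K :=
  aeval (fun i => if i = j then X j else X i + C (t i) * X j) P

/-- The shear fixes `y_j`. [folklore] -/
theorem shear_X_self [DecidableEq σ] (j : σ) (t : σ → K) : shear j t (X j : MvPolynomial σ K) = X j := by
  simp [shear]

/-- The shear sends `y_i ↦ y_i + t_i y_j` for `i ≠ j`. [folklore] -/
theorem shear_X_of_ne [DecidableEq σ] {j i : σ} (h : i ≠ j) (t : σ → K) :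
    shear j t (X i : MvPolynomial σ K) = X i + C (t i) * X j := by
  simp [shear, h]

/-- **Oblique polynomial, order part** (Hauser 2010, §I). Hauser: with variables `y = (y_m, …, y₁)`,
`z = (y_ℓ, …, y₁)` (`ℓ = m − 1`) and `p` the characteristic of the ground field, "a non-zero
polynomial `P = yʳ g(y)` with `r ∈ ℕ^m` and `g` homogeneous of degree `k` is called *oblique* with
parameters `p`, `r` and `k` if `P` has no non-trivial `p`-th power polynomial factor and if there is
a vector `t = (0, t_ℓ, …, t₁) ∈ (K*)^m` so that the polynomial `P⁺(y) = P(y + t·y_m)` has, after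
deleting all `p`-th power monomials from it, order `k + 1` with respect to the variables
`y_ℓ, …, y₁`."  Here `j` is the distinguished index (`y_j` = Hauser's `y_m`) and the structure records
`P ≠ 0`, `P = yʳ·g` with `g` homogeneous of degree `k`, and the existence of `t` (`t_j = 0`, `t_i ≠ 0`
otherwise) with `ord_z^p P⁺ = k + 1`.

RENDERING NOTE. The normalising clause "no non-trivial `p`-th power polynomial factor" is **not**
included: read literally (`qᵖ ∣ P ⇒ q` constant) it fails for the paper's own oblique polynomials
(§K: "the oblique polynomial appears at the antelope point in the form `y³z³·(y² + z²)`", divisible by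
`y²`, `z²` and `(y + z)²` in characteristic 2), and the text does not fix another reading; §I notes
only that the order condition "is stable under multiplication with homogeneous `p`-th power
polynomials". Hence the name `IsPreOblique`: every oblique polynomial in Hauser's sense satisfies it.
[cite: Hauser2010, §I (definition of oblique polynomials)] -/
structure IsPreOblique [DecidableEq σ] (p : ℕ) (j : σ) (r : σ →₀ ℕ) (k : ℕ)
    (P : MvPolynomial σ K) : Prop where
  /-- `P ≠ 0` -/
  ne_zero : P ≠ 0
  /-- `P = yʳ · g` with `g` homogeneous of degree `k` -/
  exists_homogeneous : ∃ g : MvPolynomial σ K, g.IsHomogeneous k ∧ P = monomial r 1 * g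
  /-- some shear `P⁺ = P(y + t·y_j)`, `t ∈ (K*)^{σ ∖ j}`, has `z`-order `k + 1` modulo `p`-th powers -/
  exists_shear : ∃ t : σ → K, t j = 0 ∧ (∀ i, i ≠ j → t i ≠ 0) ∧
    pOrderAwayFrom p j (shear j t P) = ((k + 1 : ℕ) : ℕ∞)

/-- The homogeneous factor `g` of a pre-oblique `P = yʳ g` is non-zero. [folklore] -/
theorem IsPreOblique.exists_g [DecidableEq σ] {p : ℕ} {j : σ} {r : σ →₀ ℕ} {k : ℕ}
    {P : MvPolynomial σ K} (h : IsPreOblique p j r k P) :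
    ∃ g : MvPolynomial σ K, g.IsHomogeneous k ∧ g ≠ 0 ∧ P = monomial r 1 * g := by
  obtain ⟨g, hg, rfl⟩ := h.exists_homogeneous
  refine ⟨g, hg, ?_, rfl⟩
  rintro rfl
  exact h.ne_zero (by simp)

/-! ### §I Example 4, verified -/

/-- Hauser 2010, §I Example 4 (`m = 2`, `p = 2`, `P = y₂y₁(y₂² + y₁²)`, `k = 2`, `t = (0, 1)`):
"`P⁺(y) = P(y₂, y₁ + y₂) = y₂y₁²(y₁ + y₂)`" — an identity in characteristic 2.
[cite: Hauser2010, §I Example 4] -/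
theorem exampleFour_char_two {A : Type*} [CommRing A] [CharP A 2] (y₁ y₂ : A) :
    y₂ * (y₁ + y₂) * (y₂ ^ 2 + (y₁ + y₂) ^ 2) = y₂ * y₁ ^ 2 * (y₁ + y₂) := by
  ring_nf
  reduce_mod_char!

/-- Example 4's polynomial `P = y₂y₁(y₂² + y₁²)` in `K[y₁, y₂]`, with `y₁ = X 0`, `y₂ = X 1`
(so Hauser's distinguished `y_m = y₂` is the index `1` and `z = y₁`). [cite: Hauser2010, §I Example 4] -/
def exampleFour (K : Type*) [CommRing K] : MvPolynomial (Fin 2) K :=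
  X 1 * X 0 * (X 1 ^ 2 + X 0 ^ 2)

/-- Example 4's vector `t = (0, 1)`: `t_{y₂} = 0`, `t_{y₁} = 1`. [cite: Hauser2010, §I Example 4] -/
def exampleFourShift (K : Type*) [CommRing K] : Fin 2 → K := fun i => if i = 1 then 0 else 1

/-- `P⁺ = P(y₂, y₁ + y₂) = y₁³y₂ + y₁²y₂²` in characteristic 2 (Hauser: `= y₂y₁²(y₁ + y₂)`).
[cite: Hauser2010, §I Example 4] -/
theorem shear_exampleFour (K : Type*) [CommRing K] [CharP K 2] :
    shear 1 (exampleFourShift K) (exampleFour K) =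
      monomial (Finsupp.single 0 3 + Finsupp.single 1 1) 1 +
        monomial (Finsupp.single 0 2 + Finsupp.single 1 2) 1 := by
  have h : shear 1 (exampleFourShift K) (exampleFour K) =
      X 0 ^ 3 * X 1 + X 0 ^ 2 * X 1 ^ 2 := by
    have : CharP (MvPolynomial (Fin 2) K) 2 := inferInstance
    simp [shear, exampleFour, exampleFourShift]
    ring_nf
    reduce_mod_char!
  rw [h, X_pow_eq_monomial, X_pow_eq_monomial, X_pow_eq_monomial, X, monomial_mul, monomial_mul]
  simp

/-- After deleting the square monomial `y₁²y₂²`, `P⁺` becomes `y₁³y₂` (characteristic 2).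
[cite: Hauser2010, §I Example 4] -/
theorem deletePthPowers_shear_exampleFour (K : Type*) [CommRing K] [CharP K 2] :
    deletePthPowers 2 (shear 1 (exampleFourShift K) (exampleFour K)) =
      monomial (Finsupp.single 0 3 + Finsupp.single 1 1) 1 := by
  have h31 : ¬ IsPthPowerExponent 2 (Finsupp.single (0 : Fin 2) 3 + Finsupp.single 1 1) := by
    rw [isPthPowerExponent_iff]
    intro h
    simpa using h 0
  have h22 : IsPthPowerExponent 2 (Finsupp.single (0 : Fin 2) 2 + Finsupp.single 1 2) := by
    rw [isPthPowerExponent_iff]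
    intro i
    fin_cases i <;> simp
  rw [shear_exampleFour, deletePthPowers_add, deletePthPowers_monomial, deletePthPowers_monomial,
    if_neg h31, if_pos h22, add_zero]

/-- Hauser 2010, §I Example 4: "`P⁺(y) = P(y₂, y₁ + y₂) = y₂y₁²(y₁ + y₂)` has modulo squares order
`3` with respect to `y₁`" — i.e. `ord^2_{y₁} P⁺ = 3 = k + 1`, the order condition of obliqueness with
`k = 2`, for `K` of characteristic 2. [cite: Hauser2010, §I Example 4] -/
theorem pOrderAwayFrom_exampleFour (K : Type*) [CommRing K] [CharP K 2] [Nontrivial K] :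
    pOrderAwayFrom 2 1 (shear 1 (exampleFourShift K) (exampleFour K)) = 3 := by
  classical
  rw [pOrderAwayFrom, deletePthPowers_shear_exampleFour,
    show (3 : ℕ∞) = ((3 : ℕ) : ℕ∞) from rfl, orderAwayFrom_eq_natCast_iff]
  have hdeg : (Finsupp.single (0 : Fin 2) 3 + Finsupp.single 1 1).degree -
      (Finsupp.single (0 : Fin 2) 3 + Finsupp.single 1 1 : Fin 2 →₀ ℕ) 1 = 3 := by
    rw [Finsupp.degree_eq_sum, Fin.sum_univ_two]
    simp
  constructor
  · exact ⟨_, by simp, hdeg⟩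
  · intro d hd
    rw [coeff_monomial] at hd
    split_ifs at hd with h
    · subst h; rw [hdeg]
    · exact absurd rfl hd

/-- Example 4 satisfies the order part of obliqueness with parameters `p = 2`, `r = (1, 1)`, `k = 2`
(and `g = y₂² + y₁²`), over any field of characteristic 2. [cite: Hauser2010, §I Example 4] -/
theorem isPreOblique_exampleFour (K : Type*) [Field K] [CharP K 2] :
    IsPreOblique 2 1 (Finsupp.single 0 1 + Finsupp.single 1 1) 2 (exampleFour K) where
  ne_zero := by
    intro h
    have h3 := pOrderAwayFrom_exampleFour K
    rw [h] at h3
    simp [shear, pOrderAwayFrom, deletePthPowers_zero, orderAwayFrom_zero] at h3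
  exists_homogeneous := by
    refine ⟨X 1 ^ 2 + X 0 ^ 2, ?_, ?_⟩
    · exact ((isHomogeneous_X K 1).pow 2).add ((isHomogeneous_X K 0).pow 2)
    · rw [exampleFour, show (monomial (Finsupp.single (0 : Fin 2) 1 + Finsupp.single 1 1) (1 : K)) =
          X 1 * X 0 by rw [add_comm, X, X, monomial_mul, one_mul]]
  exists_shear := ⟨exampleFourShift K, by simp [exampleFourShift], fun i hi => by
    fin_cases i <;> simp_all [exampleFourShift], pOrderAwayFrom_exampleFour K⟩

end Oblique

/-! ## §K — the simplest wild singularity and kangaroo point (characteristic 2) -/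

section ExampleK

variable {A : Type*} [CommRing A]

/-- `f⁰ = x² + 1·(y⁷ + yz⁴)`, the equation at the oasis point `a₀` (Hauser 2010, §K).
[cite: Hauser2010, §K Example] -/
def exampleK0 (x y z : A) : A := x ^ 2 + (y ^ 7 + y * z ^ 4)

/-- `f¹ = x² + y³·(y² + z⁴)` (Hauser 2010, §K). [cite: Hauser2010, §K Example] -/
def exampleK1 (x y z : A) : A := x ^ 2 + y ^ 3 * (y ^ 2 + z ^ 4)

/-- `f² = x² + y³z³·(y² + z²)`, the equation at the antelope point `a₂`; `y³z³(y² + z²)` is the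
oblique polynomial (Hauser 2010, §K). [cite: Hauser2010, §K Example] -/
def exampleK2 (x y z : A) : A := x ^ 2 + y ^ 3 * z ^ 3 * (y ^ 2 + z ^ 2)

/-- `f³ = x² + z⁶·(y⁵ + y⁴ + y³ + y²)`, the equation at the kangaroo point `a₃` (Hauser 2010, §K).
[cite: Hauser2010, §K Example] -/
def exampleK3 (x y z : A) : A := x ^ 2 + z ^ 6 * (y ^ 5 + y ^ 4 + y ^ 3 + y ^ 2)

/-- First point blowup `(x,y,z) → (xy, y, zy)`: the total transform of `f⁰` is `y²·f¹` (exceptional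
factor `y^{ord f⁰} = y²`, strict transform `f¹`); valid over any ring. [cite: Hauser2010, §K Example] -/
theorem exampleK0_blowup (x y z : A) : exampleK0 (x * y) y (z * y) = y ^ 2 * exampleK1 x y z := by
  unfold exampleK0 exampleK1; ring

/-- Second point blowup `(x,y,z) → (xz, yz, z)`: `f¹ ↦ z²·f²`; valid over any ring.
[cite: Hauser2010, §K Example] -/
theorem exampleK1_blowup (x y z : A) : exampleK1 (x * z) (y * z) z = z ^ 2 * exampleK2 x y z := by
  unfold exampleK1 exampleK2; ring

/-- Third point blowup followed by the translation to the kangaroo point, `(x,y,z) → (xz, yz + z, z)`: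
`f² ↦ z²·f³` in characteristic 2 (over `ℤ` the strict transform is
`x² + z⁶(y+1)³((y+1)² + 1)`, which reduces to `f³` mod 2). [cite: Hauser2010, §K Example] -/
theorem exampleK2_blowup [CharP A 2] (x y z : A) :
    exampleK2 (x * z) (y * z + z) z = z ^ 2 * exampleK3 x y z := by
  unfold exampleK2 exampleK3
  ring_nf
  reduce_mod_char!

/-- At the kangaroo point, "the coordinate change `x → x + yz³` eliminates `y²z⁶`, realizes the
shade and produces `f³ = x² + z⁶·(y⁵ + y⁴ + y³)`" (characteristic 2). [cite: Hauser2010, §K Example] -/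
theorem exampleK3_shift [CharP A 2] (x y z : A) :
    exampleK3 (x + y * z ^ 3) y z = x ^ 2 + z ^ 6 * (y ^ 5 + y ^ 4 + y ^ 3) := by
  unfold exampleK3
  ring_nf
  reduce_mod_char!

/-- At the antelope point the residual factor `y² + z²` of the oblique polynomial `y³z³(y² + z²)` is
the square `(y + z)²` in characteristic 2 (§I Example 5: "`P` has as non-monomial factor `g(y)` the
square `(y₂ + y₁)²`"). [cite: Hauser2010, §I Example 5] -/
theorem exampleK_antelope_sq [CharP A 2] (y z : A) :
    y ^ 3 * z ^ 3 * (y ^ 2 + z ^ 2) = y ^ 3 * z ^ 3 * (y + z) ^ 2 := by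
  ring_nf
  reduce_mod_char!

/-- "In `y³z³·(y² + z²)` the monomial `y³z³` is exceptional and the remaining factor `y² + z²` has
order 2" — so `shade_{a₂} f² = 2` (Hauser 2010, §K). Here: `ord₀ (y² + z²) = 2` in `K[y,z]`, `K`
any nontrivial commutative ring. [cite: Hauser2010, §K Example] -/
theorem ordZero_exampleK_antelope {K : Type*} [CommRing K] [Nontrivial K] :
    ordZero (X 0 ^ 2 + X 1 ^ 2 : MvPolynomial (Fin 2) K) = 2 := by
  classical
  rw [show (2 : ℕ∞) = ((2 : ℕ) : ℕ∞) from rfl, ordZero_eq_nat_iff]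
  constructor
  · refine ⟨Finsupp.single 0 2, ?_, by simp⟩
    simp [coeff_X_pow, Finsupp.single_eq_single_iff]
  · intro d hd
    simp only [coeff_add, coeff_X_pow]
    have h0 : Finsupp.single (0 : Fin 2) 2 ≠ d := by
      rintro rfl; simp at hd
    have h1 : Finsupp.single (1 : Fin 2) 2 ≠ d := by
      rintro rfl; simp at hd
    simp [h0, h1]

/-- "… whereas in `z⁶·(y⁵ + y⁴ + y³)` the exceptional factor is `z⁶` and the remaining factor
`y⁵ + y⁴ + y³` has order 3. Thus `shade_{a₃} f³ = 3 > 2 = shade_{a₂} f²`" (Hauser 2010, §K): the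
increase of the shade at the kangaroo point. Here: `ord₀ (y⁵ + y⁴ + y³) = 3`.
[cite: Hauser2010, §K Example] -/
theorem ordZero_exampleK_kangaroo {K : Type*} [CommRing K] [Nontrivial K] :
    ordZero (X 0 ^ 5 + X 0 ^ 4 + X 0 ^ 3 : MvPolynomial (Fin 2) K) = 3 := by
  classical
  rw [show (3 : ℕ∞) = ((3 : ℕ) : ℕ∞) from rfl, ordZero_eq_nat_iff]
  constructor
  · refine ⟨Finsupp.single 0 3, ?_, by simp⟩
    simp [coeff_X_pow, Finsupp.single_eq_single_iff]
  · intro d hd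
    simp only [coeff_add, coeff_X_pow]
    have h5 : Finsupp.single (0 : Fin 2) 5 ≠ d := by
      rintro rfl; simp at hd
    have h4 : Finsupp.single (0 : Fin 2) 4 ≠ d := by
      rintro rfl; simp at hd
    have h3 : Finsupp.single (0 : Fin 2) 3 ≠ d := by
      rintro rfl; simp at hd
    simp [h5, h4, h3]

/-- The shade jumps from `2` to `3` between the antelope point `a₂` and the kangaroo point `a₃` while
the order stays `2 = p` (Hauser 2010, §K, last paragraph), as the inequality of residual orders.
[cite: Hauser2010, §K Example] -/
theorem ordZero_exampleK_lt {K : Type*} [CommRing K] [Nontrivial K] :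
    ordZero (X 0 ^ 2 + X 1 ^ 2 : MvPolynomial (Fin 2) K) <
      ordZero (X 0 ^ 5 + X 0 ^ 4 + X 0 ^ 3 : MvPolynomial (Fin 2) K) := by
  rw [ordZero_exampleK_antelope, ordZero_exampleK_kangaroo]
  decide

/-! ### The antelope initial form of §K satisfies the oblique order condition -/

/-- The oblique polynomial of §K / §I Example 5, `P = y₂³y₁³(y₂² + y₁²)` (`p = 2`, `r = (3, 3)`,
`k = 2`), in `K[y₁, y₂]` with `y₁ = X 0`, `y₂ = X 1`. [cite: Hauser2010, §K Example and §I Example 5] -/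
def exampleFive (K : Type*) [CommRing K] : MvPolynomial (Fin 2) K :=
  X 1 ^ 3 * X 0 ^ 3 * (X 1 ^ 2 + X 0 ^ 2)

/-- `P⁺ = P(y₂, y₁ + y₂) = y₁⁵y₂³ + y₁⁴y₂⁴ + y₁³y₂⁵ + y₁²y₂⁶` in characteristic 2 (`t = (0, 1)`, the
translation `(x,y,z) → (xz, yz + z, z)` of §K restricted to the exceptional divisor). [folklore] -/
theorem shear_exampleFive (K : Type*) [CommRing K] [CharP K 2] :
    shear 1 (exampleFourShift K) (exampleFive K) =
      monomial (Finsupp.single 0 5 + Finsupp.single 1 3) 1 +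
        monomial (Finsupp.single 0 4 + Finsupp.single 1 4) 1 +
        monomial (Finsupp.single 0 3 + Finsupp.single 1 5) 1 +
        monomial (Finsupp.single 0 2 + Finsupp.single 1 6) 1 := by
  have h : shear 1 (exampleFourShift K) (exampleFive K) =
      X 0 ^ 5 * X 1 ^ 3 + X 0 ^ 4 * X 1 ^ 4 + X 0 ^ 3 * X 1 ^ 5 + X 0 ^ 2 * X 1 ^ 6 := by
    have : CharP (MvPolynomial (Fin 2) K) 2 := inferInstance
    simp [shear, exampleFive, exampleFourShift]
    ring_nf
    reduce_mod_char!
  rw [h]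
  simp only [X_pow_eq_monomial, monomial_mul, mul_one]

/-- Deleting the square monomials `y₁⁴y₂⁴`, `y₁²y₂⁶` leaves `y₁⁵y₂³ + y₁³y₂⁵`. [folklore] -/
theorem deletePthPowers_shear_exampleFive (K : Type*) [CommRing K] [CharP K 2] :
    deletePthPowers 2 (shear 1 (exampleFourShift K) (exampleFive K)) =
      monomial (Finsupp.single 0 5 + Finsupp.single 1 3) 1 +
        monomial (Finsupp.single 0 3 + Finsupp.single 1 5) 1 := by
  have h53 : ¬ IsPthPowerExponent 2 (Finsupp.single (0 : Fin 2) 5 + Finsupp.single 1 3) := by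
    rw [isPthPowerExponent_iff]; intro h; simpa using h 0
  have h44 : IsPthPowerExponent 2 (Finsupp.single (0 : Fin 2) 4 + Finsupp.single 1 4) := by
    rw [isPthPowerExponent_iff]; intro i; fin_cases i <;> simp
  have h35 : ¬ IsPthPowerExponent 2 (Finsupp.single (0 : Fin 2) 3 + Finsupp.single 1 5) := by
    rw [isPthPowerExponent_iff]; intro h; simpa using h 0
  have h26 : IsPthPowerExponent 2 (Finsupp.single (0 : Fin 2) 2 + Finsupp.single 1 6) := by
    rw [isPthPowerExponent_iff]; intro i; fin_cases i <;> simp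
  rw [shear_exampleFive, deletePthPowers_add, deletePthPowers_add, deletePthPowers_add,
    deletePthPowers_monomial, deletePthPowers_monomial, deletePthPowers_monomial,
    deletePthPowers_monomial, if_neg h53, if_pos h44, if_neg h35, if_pos h26, add_zero, add_zero]

/-- The initial form `y₂³y₁³(y₂² + y₁²)` at the antelope point of §K satisfies the order condition of
obliqueness: `ord^2_{y₁} P⁺ = 3 = k + 1` (`k = 2`) — consistent with §I ("the condition
`ord^p_z P⁺ ≥ k + 1` on `P⁺` is a prerequisite for the occurence of a kangaroo point") and with the
shade `3` found at the kangaroo point in §K. [cite: Hauser2010, §I (after Example 4) and §K] -/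
theorem pOrderAwayFrom_exampleFive (K : Type*) [CommRing K] [CharP K 2] [Nontrivial K] :
    pOrderAwayFrom 2 1 (shear 1 (exampleFourShift K) (exampleFive K)) = 3 := by
  classical
  rw [pOrderAwayFrom, deletePthPowers_shear_exampleFive,
    show (3 : ℕ∞) = ((3 : ℕ) : ℕ∞) from rfl, orderAwayFrom_eq_natCast_iff]
  have hne : (Finsupp.single (0 : Fin 2) 5 + Finsupp.single 1 3 : Fin 2 →₀ ℕ) ≠
      Finsupp.single 0 3 + Finsupp.single 1 5 := by
    intro h
    have := DFunLike.congr_fun h 0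
    simp at this
  have hdeg35 : (Finsupp.single (0 : Fin 2) 3 + Finsupp.single 1 5).degree -
      (Finsupp.single (0 : Fin 2) 3 + Finsupp.single 1 5 : Fin 2 →₀ ℕ) 1 = 3 := by
    rw [Finsupp.degree_eq_sum, Fin.sum_univ_two]; simp
  have hdeg53 : (Finsupp.single (0 : Fin 2) 5 + Finsupp.single 1 3).degree -
      (Finsupp.single (0 : Fin 2) 5 + Finsupp.single 1 3 : Fin 2 →₀ ℕ) 1 = 5 := by
    rw [Finsupp.degree_eq_sum, Fin.sum_univ_two]; simp
  constructor
  · refine ⟨Finsupp.single 0 3 + Finsupp.single 1 5, ?_, hdeg35⟩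
    simp [coeff_monomial, hne]
  · intro d hd
    simp only [coeff_add, coeff_monomial] at hd
    by_cases h1 : Finsupp.single (0 : Fin 2) 5 + Finsupp.single 1 3 = d
    · subst h1; rw [hdeg53]; norm_num
    · by_cases h2 : Finsupp.single (0 : Fin 2) 3 + Finsupp.single 1 5 = d
      · subst h2; rw [hdeg35]
      · simp [h1, h2] at hd

/-- Hence the §K initial form satisfies `IsPreOblique 2 y₂ (3,3) 2` over any field of characteristic
2, with `g = y₂² + y₁²`. [cite: Hauser2010, §K ("The oblique polynomial appears at the antelope point
a₂ in the form y³z³·(y² + z²)")] -/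
theorem isPreOblique_exampleFive (K : Type*) [Field K] [CharP K 2] :
    IsPreOblique 2 1 (Finsupp.single 0 3 + Finsupp.single 1 3) 2 (exampleFive K) where
  ne_zero := by
    intro h
    have h3 := pOrderAwayFrom_exampleFive K
    rw [h] at h3
    simp [shear, pOrderAwayFrom, deletePthPowers_zero, orderAwayFrom_zero] at h3
  exists_homogeneous := by
    refine ⟨X 1 ^ 2 + X 0 ^ 2, ?_, ?_⟩
    · exact ((isHomogeneous_X K 1).pow 2).add ((isHomogeneous_X K 0).pow 2)
    · rw [exampleFive, show (monomial (Finsupp.single (0 : Fin 2) 3 + Finsupp.single 1 3) (1 : K)) =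
          X 1 ^ 3 * X 0 ^ 3 by rw [add_comm, X_pow_eq_monomial, X_pow_eq_monomial, monomial_mul, one_mul]]
  exists_shear := ⟨exampleFourShift K, by simp [exampleFourShift], fun i hi => by
    fin_cases i <;> simp_all [exampleFourShift], pOrderAwayFrom_exampleFive K⟩

end ExampleK

end Literature.AlgebraicGeometry.Resolution.Hauser2010

end
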